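import Mathlib
import Summits.NavierStokesRegularity.NavierStokesRegularity.Theorems.EulerZoomLiouvillePowerGaugeEulerLiouvilleKelvinPhysical
import Summits.NavierStokesRegularity.NavierStokesRegularity.Theorems.EulerZoomLiouvillePowerGaugeEulerLiouvilleSelfSimilarKelvinFarField
import Literature.Analysis.ODE.LinearNormBound
import HarnessLib.Audit

/-!
# Crux `EulerZoomLiouville.PowerGaugeEulerLiouville`: the FAR-FIELD KELVIN BOUND IN PHYSICAL VARIABLES
# — classical energy-concentrating ancient Euler flows have compactly supported vorticity

Route №10 `EulerZoomLiouville` (NavierStokesRegularity), crux E = stmt-NavierStokesRegularity-19832,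
registered residue `stub_nonSelfSimilar` (energetic-past members that are not exactly self-similar,
⊇ the discretely self-similar ones) and the endpoint of `stub_selfSimilarExtremal`.  Sequel to
`…KelvinPhysical` (torus-averaged Kelvin: `∫ ⟪u(t, X_t a), DX_t(a)B(a)⟫ da = ∫ ⟪u(t₀), B⟫`).

SETTING (a classical member near a potential collapse at the space–time origin, in the similarity
scaling `x ~ (−τ)^γ`, `u ~ (−τ)^{γ−1}` of the class, `γ = 1/(2+ρ)`; `γ = 2/5` at the endpoint):
`(u, p)` classical Euler on `(−∞, 0)` with the Cauchy–Lipschitz hypotheses and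
* (a) velocity bound `‖u(τ, x)‖ ≤ M (−τ)^{γ−1}`;
* (b) far-field gradient smallness `‖∇u(τ, x)‖ ≤ ε/(−τ)` for `‖x‖ ≥ R (−τ)^γ`;
* (c) tail energy in similarity scaling: `∫_{|x| ≥ r} |u(τ)|² ≤ C r^{−β} (−τ)^{γβ}` for
  `r ≥ R₀ (−τ)^γ`.

* `norm_evolutionMap_sub_le` — bounded displacement `‖X_t a − a‖ ≤ (M/γ)((−t₀)^γ − (−t)^γ)`;
* `norm_fderiv_evolutionMap_le_exp` — along far trajectories `‖DX_t(a)‖ ≤ e^{ε(log(−t₀) − log(−t))}`;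
* `abs_integral_inner_le_exp` — **THE FAR-FIELD KELVIN BOUND**: for `B ∈ C_c^∞` divergence-free
  supported in `{|a| ≥ L}`, `L ≥ (max R R₀ + M/γ)(−t₀)^γ`:
  `|∫ ⟪u(t₀), B⟫| ≤ ½ ‖B‖_∞ e^{ε(log(−t₀)−log(−t))} (C r₁^{−β} + vol(supp B)) e^{(γβ/2) log(−t)}` for all
  `t ∈ [t₀, 0)`, `r₁ = L − (M/γ)(−t₀)^γ`;
* (sequel `…KelvinPhysicalCompactVorticity`: if `ε < γβ/2` the right side tends to `0` as
  `t → 0⁻`, so `∫ ⟪u(t₀), B⟫ = 0` and `curl u(t₀)` vanishes outside the ball of radius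
  `(max R R₀ + |M|/γ + 1)(−t₀)^γ`; `…ClassicalConcentrating`: the member-level stratum.)

WHAT THIS IS NOT: not NS, not E — CLASSICAL members only, under the explicit concentration-rate
hypotheses (a)–(c); the weak class is untouched.

## References

* A. J. Majda, A. L. Bertozzi, *Vorticity and Incompressible Flow*, CUP 2002, §1.6, §4.2 (4.45)–(4.47).
  [MajdaBertozziCUP2002]
* D. Chae, J. Wolf, Comm. Math. Phys. 376 (2020) = arXiv:1706.02020, Thm 3.1 / §3.4 (one-point energy
  concentration under Type I; there via the local pressure). [ChaeWolf2020EulerTypeI]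
-/

noncomputable section

-- flat `Theorems/<Route><Decl>…` files of one crux share the namespace of the crux (tree convention)
set_option linter.dupNamespace false

open MeasureTheory Set Filter Topology Metric Function InnerProductSpace
open scoped RealInnerProductSpace NNReal ENNReal ContDiff

namespace Summit.NavierStokesRegularity.NavierStokesRegularity.Theorems.PowerGaugeEulerLiouville.KelvinPhysical

open Literature.Analysis Literature.Analysis.FunctionSpaces Literature.Analysis.FluidPDE

variable {u : ℝ → EuclideanSpace ℝ (Fin 3) → EuclideanSpace ℝ (Fin 3)}
  {p : ℝ → EuclideanSpace ℝ (Fin 3) → ℝ} {γ : ℝ}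

/-! ### Bounded displacement and the gradient along far trajectories -/

/-- **Bounded displacement under the similarity velocity bound**: if `‖u(τ, x)‖ ≤ M(−τ)^{γ−1}`
(`γ > 0`) then `‖X_t a − a‖ ≤ (M/γ)((−t₀)^γ − (−t)^γ)` for `t₀ ≤ t < 0`.
[cite: MajdaBertozziCUP2002, §4.2 eq. (4.46)] -/
theorem norm_evolutionMap_sub_le (hL : ODE.IsUniformlyLipschitzOn u (Iio 0)) (hγ : 0 < γ) {M : ℝ}
    (hM : ∀ τ : ℝ, τ < 0 → ∀ x, ‖u τ x‖ ≤ M * (-τ) ^ (γ - 1)) {t₀ t : ℝ} (ht₀t : t₀ ≤ t)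
    (ht : t < 0) (a : EuclideanSpace ℝ (Fin 3)) :
    ‖ODE.evolutionMap u t₀ t a - a‖ ≤ M / γ * ((-t₀) ^ γ - (-t) ^ γ) := by
  have ht₀ : t₀ < 0 := lt_of_le_of_lt ht₀t ht
  have hsub : uIcc t₀ t ⊆ Iio 0 := by
    rw [uIcc_of_le ht₀t]; exact fun s hs => lt_of_le_of_lt hs.2 ht
  have hcont : ContinuousOn (fun s : ℝ => M * (-s) ^ (γ - 1)) (uIcc t₀ t) := by
    refine continuousOn_const.mul (ContinuousOn.rpow_const (continuousOn_id.neg) fun s hs => ?_)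
    exact Or.inl (neg_ne_zero.2 (ne_of_lt (hsub hs)))
  have h := norm_evolutionMap_sub_self_le_abs_integral hL (convex_Iio 0) ht₀ ht hcont
    (fun s hs x => hM s (hsub hs) x) a
  refine h.trans (le_of_eq ?_)
  -- `∫_{t₀}^t M(−s)^{γ−1} ds = (M/γ)((−t₀)^γ − (−t)^γ)`
  have hderiv : ∀ s ∈ uIcc t₀ t, HasDerivAt (fun s : ℝ => -(M / γ) * (-s) ^ γ)
      (M * (-s) ^ (γ - 1)) s := by
    intro s hs
    have hs0 : -s ≠ 0 := neg_ne_zero.2 (ne_of_lt (hsub hs))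
    have h1 := ((hasDerivAt_neg s).rpow_const (p := γ) (Or.inl hs0)).const_mul (-(M / γ))
    refine h1.congr_deriv ?_
    field_simp
  have hint : IntervalIntegrable (fun s : ℝ => M * (-s) ^ (γ - 1)) volume t₀ t :=
    hcont.intervalIntegrable
  rw [intervalIntegral.integral_eq_sub_of_hasDerivAt hderiv hint]
  have hpos : 0 ≤ M / γ * ((-t₀) ^ γ - (-t) ^ γ) := by
    have hM0 : 0 ≤ M := by
      have := hM t ht 0
      have hp : 0 < (-t) ^ (γ - 1) := Real.rpow_pos_of_pos (by linarith) _
      nlinarith [norm_nonneg (u t 0)]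
    have hmono : (-t) ^ γ ≤ (-t₀) ^ γ := Real.rpow_le_rpow (by linarith) (by linarith) hγ.le
    exact mul_nonneg (div_nonneg hM0 hγ.le) (by linarith)
  rw [abs_of_nonneg (by linarith)]
  ring

/-- **The gradient of the flow along a far trajectory**: if `‖∇u(s, x)‖ ≤ ε/(−s)` whenever
`‖x‖ ≥ R(−s)^γ`, `‖u‖ ≤ M(−τ)^{γ−1}`, and `‖a‖ − (M/γ)(−t₀)^γ ≥ R(−t₀)^γ` (`R ≥ 0`), then for
`t₀ ≤ t < 0`, `‖DX_t(a)‖ ≤ exp(ε (log(−t₀) − log(−t)))` (Grönwall with the modulus `ε/(−s)`).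
[cite: MajdaBertozziCUP2002, §4.2 eq. (4.47)] -/
theorem norm_fderiv_evolutionMap_le_exp (h : IsClassicalEulerSolutionOn (Iio 0) 0 u p)
    (hL : ODE.IsUniformlyLipschitzOn u (Iio 0)) (hγ : 0 < γ) {M : ℝ}
    (hM : ∀ τ : ℝ, τ < 0 → ∀ x, ‖u τ x‖ ≤ M * (-τ) ^ (γ - 1)) {ε R : ℝ} (hR : 0 ≤ R)
    (hfar : ∀ τ : ℝ, τ < 0 → ∀ x : EuclideanSpace ℝ (Fin 3), R * (-τ) ^ γ ≤ ‖x‖ →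
      ‖fderiv ℝ (u τ) x‖ ≤ ε / (-τ))
    {t₀ t : ℝ} (ht₀t : t₀ ≤ t) (ht : t < 0) {a : EuclideanSpace ℝ (Fin 3)}
    (ha : R * (-t₀) ^ γ ≤ ‖a‖ - M / γ * (-t₀) ^ γ) :
    ‖fderiv ℝ (ODE.evolutionMap u t₀ t) a‖ ≤ Real.exp (ε * (Real.log (-t₀) - Real.log (-t))) := by
  have ht₀ : t₀ < 0 := lt_of_le_of_lt ht₀t ht
  have hsub : uIcc t₀ t ⊆ Iio 0 := by
    rw [uIcc_of_le ht₀t]; exact fun s hs => lt_of_le_of_lt hs.2 ht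
  have hU : UniqueDiffOn ℝ (Iio (0 : ℝ)) := isOpen_Iio.uniqueDiffOn
  -- far along the whole trajectory
  have hfarX : ∀ s ∈ uIcc t₀ t, R * (-s) ^ γ ≤ ‖ODE.evolutionMap u t₀ s a‖ := by
    intro s hs
    have hs' : t₀ ≤ s ∧ s ≤ t := by rwa [uIcc_of_le ht₀t] at hs
    have hs0 : s < 0 := hsub hs
    have hdisp := norm_evolutionMap_sub_le hL hγ hM hs'.1 hs0 a
    have h1 : ‖a‖ - M / γ * ((-t₀) ^ γ - (-s) ^ γ) ≤ ‖ODE.evolutionMap u t₀ s a‖ := by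
      have := norm_sub_norm_le a (ODE.evolutionMap u t₀ s a)
      rw [← norm_neg, neg_sub] at hdisp
      linarith
    have hM0 : 0 ≤ M := by
      have := hM t ht 0
      have hp : 0 < (-t) ^ (γ - 1) := Real.rpow_pos_of_pos (by linarith) _
      nlinarith [norm_nonneg (u t 0)]
    have h2 : (-s) ^ γ ≤ (-t₀) ^ γ := Real.rpow_le_rpow (by linarith) (by linarith) hγ.le
    have h3 : 0 ≤ (-s) ^ γ := Real.rpow_nonneg (by linarith) _
    have h4 : R * (-s) ^ γ ≤ R * (-t₀) ^ γ := mul_le_mul_of_nonneg_left h2 hR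
    nlinarith [div_nonneg hM0 hγ.le]
  -- Grönwall with modulus `ε/(−s)`
  have hcontM : ContinuousOn (fun s : ℝ => ε / (-s)) (uIcc t₀ t) :=
    continuousOn_const.div continuousOn_id.neg fun s hs => neg_ne_zero.2 (ne_of_lt (hsub hs))
  have key := ODE.norm_le_mul_exp_abs_integral_of_norm_deriv_le_uIcc (M := fun s => ε / (-s))
    (g := fun r => fderiv ℝ (ODE.evolutionMap u t₀ r) a)
    (g' := fun r => (fderiv ℝ (u r) (ODE.evolutionMap u t₀ r a)).comp
      (fderiv ℝ (ODE.evolutionMap u t₀ r) a))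
    (fun s hs => (hasDerivWithinAt_fderiv_evolutionMap hL h.smooth_velocity (convex_Iio 0) hU ht₀
      (hsub hs) a).mono hsub) hcontM
    (fun s hs => (ContinuousLinearMap.opNorm_comp_le _ _).trans
      (mul_le_mul_of_nonneg_right (hfar s (hsub hs) _ (hfarX s hs)) (norm_nonneg _)))
  rw [fderiv_evolutionMap_self] at key
  refine key.trans ((mul_le_of_le_one_left (Real.exp_pos _).le ContinuousLinearMap.norm_id_le).trans
    (le_of_eq ?_))
  -- `∫_{t₀}^t ε/(−s) ds = ε (log(−t₀) − log(−t))`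
  have hderiv : ∀ s ∈ uIcc t₀ t, HasDerivAt (fun s : ℝ => -ε * Real.log (-s)) (ε / (-s)) s := by
    intro s hs
    have hs0 : -s ≠ 0 := neg_ne_zero.2 (ne_of_lt (hsub hs))
    have h1 := ((hasDerivAt_neg s).log hs0).const_mul (-ε)
    refine h1.congr_deriv ?_
    field_simp
  rw [intervalIntegral.integral_eq_sub_of_hasDerivAt hderiv hcontM.intervalIntegrable]
  congr 1
  have hlog : Real.log (-t) ≤ Real.log (-t₀) := Real.log_le_log (by linarith) (by linarith)
  have hε : 0 ≤ ε := by
    have h0 := hfar t ht (ODE.evolutionMap u t₀ t a) (hfarX t right_mem_uIcc)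
    have : 0 ≤ ε / (-t) := (norm_nonneg _).trans h0
    exact (div_nonneg_iff.1 this).elim (fun h => h.1) fun h => absurd h.2 (not_le.2 (by linarith))
  rw [abs_of_nonneg (by nlinarith)]
  ring


/-! ### The far-field Kelvin bound in physical variables -/

/-- **THE FAR-FIELD KELVIN BOUND (physical variables).** Under (a) `‖u(τ,x)‖ ≤ M(−τ)^{γ−1}`,
(b) `‖∇u(τ,x)‖ ≤ ε/(−τ)` for `‖x‖ ≥ R(−τ)^γ`, (c) `∫_{|x|≥r}|u(τ)|² ≤ C r^{−β}(−τ)^{γβ}` for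
`r ≥ R₀(−τ)^γ`, a divergence-free test field `B` supported in `{|a| ≥ L}` with
`L ≥ (max R R₀ + M/γ)(−t₀)^γ`, and every `t ∈ [t₀, 0)`:
`|∫ ⟪u(t₀), B⟫| ≤ ‖B‖_∞ e^{ε(log(−t₀) − log(−t))} · ½(C r₁^{−β} + vol(supp B)) · e^{(γβ/2) log(−t)}`,
`r₁ = L − (M/γ)(−t₀)^γ` (Kelvin + far-trajectory Grönwall + volume preservation + AM–GM).
[cite: MajdaBertozziCUP2002, §1.6 Prop. 1.11; ChaeWolf2020EulerTypeI, §3.4 (the role of Type I)] -/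
theorem abs_integral_inner_le_exp (h : IsClassicalEulerSolutionOn (Iio 0) 0 u p)
    (hL : ODE.IsUniformlyLipschitzOn u (Iio 0)) (hγ : 0 < γ) {M : ℝ}
    (hM : ∀ τ : ℝ, τ < 0 → ∀ x, ‖u τ x‖ ≤ M * (-τ) ^ (γ - 1)) {ε R : ℝ} (hR : 0 ≤ R)
    (hfar : ∀ τ : ℝ, τ < 0 → ∀ x : EuclideanSpace ℝ (Fin 3), R * (-τ) ^ γ ≤ ‖x‖ →
      ‖fderiv ℝ (u τ) x‖ ≤ ε / (-τ))
    {β C R₀ : ℝ} (hR₀ : 0 ≤ R₀)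
    (htail : ∀ τ : ℝ, τ < 0 → ∀ r : ℝ, R₀ * (-τ) ^ γ ≤ r →
      ∫ x in {x | r ≤ ‖x‖}, ‖u τ x‖ ^ 2 ≤ C * r ^ (-β) * (-τ) ^ (γ * β))
    (hu2 : ∀ τ : ℝ, τ < 0 → Integrable (fun x => ‖u τ x‖ ^ 2) volume)
    {t₀ : ℝ} {L : ℝ} (hLR : (R + M / γ) * (-t₀) ^ γ ≤ L) (hLR₀ : (R₀ + M / γ) * (-t₀) ^ γ ≤ L)
    (hL0 : M / γ * (-t₀) ^ γ < L)
    {B : EuclideanSpace ℝ (Fin 3) → EuclideanSpace ℝ (Fin 3)} (hB : ContDiff ℝ ∞ B)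
    (hBc : HasCompactSupport B) (hBdiv : VectorCalculus.IsDivFree B)
    (hBL : ∀ a ∈ tsupport B, L ≤ ‖a‖) {Bmax : ℝ} (hBmax : ∀ a, ‖B a‖ ≤ Bmax)
    {t : ℝ} (ht₀t : t₀ ≤ t) (ht : t < 0) :
    |∫ a, ⟪u t₀ a, B a⟫| ≤ Bmax * Real.exp (ε * (Real.log (-t₀) - Real.log (-t))) *
      ((C * (L - M / γ * (-t₀) ^ γ) ^ (-β) + (volume (tsupport B)).toReal) / 2 *
        Real.exp (γ * β / 2 * Real.log (-t))) := by
  have ht₀ : t₀ < 0 := lt_of_le_of_lt ht₀t ht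
  have hU : UniqueDiffOn ℝ (Iio (0 : ℝ)) := isOpen_Iio.uniqueDiffOn
  set X := ODE.evolutionMap u t₀ t with hX
  set T := tsupport B with hT
  have hTc : IsCompact T := hBc
  have hTm : MeasurableSet T := hTc.measurableSet
  have hBmax0 : 0 ≤ Bmax := (norm_nonneg _).trans (hBmax 0)
  have hM0 : 0 ≤ M := by
    have := hM t ht 0
    have hp : 0 < (-t) ^ (γ - 1) := Real.rpow_pos_of_pos (by linarith) _
    nlinarith [norm_nonneg (u t 0)]
  have hXc : Continuous X := ((hL.contDiff_evolutionMap (convex_Iio 0) hU le_top h.smooth_velocity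
    ht₀ ht).continuous)
  have huc : Continuous (u t) := (h.contDiff_velocity ht).continuous
  set r₁ := L - M / γ * (-t₀) ^ γ with hr₁
  have hr₁0 : 0 < r₁ := by rw [hr₁]; linarith
  -- (1) Kelvin
  have hKel := integral_inner_evolutionMap_eq h hL (convex_Iio 0) isOpen_Iio ht₀ ht hB hBc hBdiv
  rw [← hX] at hKel
  -- (2) pointwise bound on `T`, zero off `T`
  set G : ℝ := Real.exp (ε * (Real.log (-t₀) - Real.log (-t))) with hG
  have hJ : ∀ a ∈ T, ‖fderiv ℝ X a‖ ≤ G := by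
    intro a ha
    refine norm_fderiv_evolutionMap_le_exp h hL hγ hM hR hfar ht₀t ht ?_
    have h1 : (R + M / γ) * (-t₀) ^ γ ≤ ‖a‖ := hLR.trans (hBL a ha)
    linarith
  have hpt : ∀ a ∈ T, |⟪u t (X a), fderiv ℝ X a (B a)⟫| ≤ ‖u t (X a)‖ * (G * Bmax) := by
    intro a ha
    refine (abs_real_inner_le_norm _ _).trans (mul_le_mul_of_nonneg_left ?_ (norm_nonneg _))
    exact (ContinuousLinearMap.le_opNorm _ _).trans
      (mul_le_mul (hJ a ha) (hBmax a) (norm_nonneg _) (Real.exp_pos _).le)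
  have hzero : ∀ a ∉ T, ⟪u t (X a), fderiv ℝ X a (B a)⟫ = 0 := by
    intro a ha
    rw [hT] at ha
    simp [image_eq_zero_of_notMem_tsupport ha]
  have hcontF : Continuous fun a => ⟪u t (X a), fderiv ℝ X a (B a)⟫ :=
    (huc.comp hXc).inner (((hL.contDiff_evolutionMap (convex_Iio 0) hU le_top h.smooth_velocity
      ht₀ ht).continuous_fderiv (by simp)).clm_apply hB.continuous)
  have hQ : |∫ a, ⟪u t (X a), fderiv ℝ X a (B a)⟫| ≤ G * Bmax * ∫ a in T, ‖u t (X a)‖ := by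
    rw [← setIntegral_eq_integral_of_forall_compl_eq_zero (s := T) (fun a ha => hzero a ha)]
    refine (abs_integral_le_integral_abs).trans ?_
    calc ∫ a in T, |⟪u t (X a), fderiv ℝ X a (B a)⟫|
        ≤ ∫ a in T, ‖u t (X a)‖ * (G * Bmax) := by
          refine setIntegral_mono_on ?_ ?_ hTm hpt
          · exact (continuous_abs.comp hcontF).continuousOn.integrableOn_compact hTc
          · exact ((huc.comp hXc).norm.mul continuous_const).continuousOn.integrableOn_compact hTc
      _ = G * Bmax * ∫ a in T, ‖u t (X a)‖ := by rw [integral_mul_const]; ring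
  -- (3) volume-preserving transport
  have htrans : (∫ a in T, ‖u t (X a)‖) = ∫ x in X '' T, ‖u t x‖ :=
    (setIntegral_image_evolutionMap h hL (convex_Iio 0) hU ht₀ ht hTm (fun x => ‖u t x‖)).symm
  have hvol : volume (X '' T) = volume T := volume_image_evolutionMap h hL (convex_Iio 0) hU ht₀ ht hTm
  -- (4) the image stays far out; tail energy there
  have hfarX : X '' T ⊆ {x | r₁ ≤ ‖x‖} := by
    rintro x ⟨a, ha, rfl⟩
    have hdisp := norm_evolutionMap_sub_le hL hγ hM ht₀t ht a
    have h1 : ‖a‖ - M / γ * ((-t₀) ^ γ - (-t) ^ γ) ≤ ‖X a‖ := by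
      have := norm_sub_norm_le a (X a)
      rw [← norm_neg, neg_sub] at hdisp
      linarith
    have h2 : 0 ≤ M / γ * (-t) ^ γ := mul_nonneg (div_nonneg hM0 hγ.le) (Real.rpow_nonneg (by linarith) _)
    show r₁ ≤ ‖X a‖
    rw [hr₁]
    linarith [hBL a ha]
  have hAc : IsCompact (X '' T) := hTc.image hXc
  have hAm : MeasurableSet (X '' T) := hAc.measurableSet
  have htγ : (-t) ^ γ ≤ (-t₀) ^ γ := Real.rpow_le_rpow (by linarith) (by linarith) hγ.le
  have hr₁R₀ : R₀ * (-t) ^ γ ≤ r₁ := by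
    have : R₀ * (-t) ^ γ ≤ R₀ * (-t₀) ^ γ := mul_le_mul_of_nonneg_left htγ hR₀
    rw [hr₁]; linarith
  have htailA : ∫ x in X '' T, ‖u t x‖ ^ 2 ≤ C * r₁ ^ (-β) * (-t) ^ (γ * β) :=
    (setIntegral_mono_set (hu2 t ht).integrableOn (Eventually.of_forall fun x => by positivity)
      (Eventually.of_forall hfarX)).trans (htail t ht r₁ hr₁R₀)
  -- (5) AM–GM on the image with `l = e^{−(γβ/2) log(−t)}`
  set l : ℝ := Real.exp (-(γ * β / 2) * Real.log (-t)) with hl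
  have hl0 : 0 < l := Real.exp_pos _
  have hI1 : IntegrableOn (fun x => ‖u t x‖) (X '' T) volume :=
    huc.norm.continuousOn.integrableOn_compact hAc
  have hI2 : IntegrableOn (fun x => ‖u t x‖ ^ 2) (X '' T) volume := (hu2 t ht).integrableOn
  have hAM : (∫ x in X '' T, ‖u t x‖) ≤
      (l * (∫ x in X '' T, ‖u t x‖ ^ 2) + l⁻¹ * (volume (X '' T)).toReal) / 2 := by
    have hmono : (∫ x in X '' T, ‖u t x‖) ≤ ∫ x in X '' T, (l * ‖u t x‖ ^ 2 + l⁻¹) / 2 :=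
      setIntegral_mono_on hI1 (((hI2.const_mul l).add (integrableOn_const hAc.measure_lt_top.ne)).div_const 2)
        hAm fun x _ => Kelvin.norm_le_half_mul_sq_add_inv hl0
    refine hmono.trans (le_of_eq ?_)
    rw [integral_div, integral_add (hI2.const_mul l) (integrableOn_const hAc.measure_lt_top.ne),
      integral_const_mul, setIntegral_const, smul_eq_mul, mul_comm _ l⁻¹, measureReal_def]
  have hpowt : (-t) ^ (γ * β) = Real.exp (γ * β * Real.log (-t)) := by
    rw [Real.rpow_def_of_pos (by linarith), mul_comm]
  have himage : (∫ x in X '' T, ‖u t x‖) ≤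
      (C * r₁ ^ (-β) + (volume T).toReal) / 2 * Real.exp (γ * β / 2 * Real.log (-t)) := by
    refine hAM.trans ?_
    rw [hvol]
    have h1 : l * (∫ x in X '' T, ‖u t x‖ ^ 2) ≤ C * r₁ ^ (-β) * Real.exp (γ * β / 2 * Real.log (-t)) := by
      refine (mul_le_mul_of_nonneg_left htailA hl0.le).trans (le_of_eq ?_)
      rw [hpowt, hl, mul_comm, mul_assoc, ← Real.exp_add]; ring_nf
    have h2 : l⁻¹ * (volume T).toReal = (volume T).toReal * Real.exp (γ * β / 2 * Real.log (-t)) := by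
      rw [hl, ← Real.exp_neg]; ring_nf
    rw [h2]
    linarith [h1]
  -- (6) assemble
  rw [← hKel]
  refine hQ.trans ?_
  rw [htrans]
  have hGB : 0 ≤ G * Bmax := mul_nonneg (Real.exp_pos _).le hBmax0
  calc G * Bmax * ∫ x in X '' T, ‖u t x‖
      ≤ G * Bmax * ((C * r₁ ^ (-β) + (volume T).toReal) / 2 * Real.exp (γ * β / 2 * Real.log (-t))) :=
        mul_le_mul_of_nonneg_left himage hGB
    _ = Bmax * G * ((C * r₁ ^ (-β) + (volume T).toReal) / 2 * Real.exp (γ * β / 2 * Real.log (-t))) := by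
        ring


end Summit.NavierStokesRegularity.NavierStokesRegularity.Theorems.PowerGaugeEulerLiouville.KelvinPhysical

end
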